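import Mathlib
import Summits.Ventures.PercRepro2.Defs
import Summits.Ventures.PercRepro2.Graph
import Summits.Ventures.PercRepro2.OneColourSwitch
import Summits.Ventures.PercRepro2.RegionHubSign
import Summits.Ventures.PercRepro2.SideSwitch
import Summits.Ventures.PercRepro2.M9NoPocketDefs

/-!
# Connections that avoid `d` (blind cell PercRepro2, p3 g22, 2026-08-28)

The «`d`-avoiding split» of `proofs/P3-CPNC.md` §19g: in a colouring in which `d` lies in the
`Y`-world `K₂` of `{r, s}` and `p` does not, every `Y`-connection from `p` is a connection in the
graph `G − d` (`endsD`: `d`'s edges turned into loops) — a `Y`-path through `d` would put `p` into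
`K₂`.  Hence on the single-`d` colourings with `d` doubly reached (`d ∈ K₂ ∩ M₂`) the colour
preference `σ_pq` of `p, q` is computed in `G − d` in both colours, and with `d` reached in one
colour only it is computed in `G − d` in that colour.  These are the identities
`σ_pq = Ỹc − W̃c` on D-points and `Yc = Ỹc` on A-points of §19g (1).

* `conn_endsD_of_not_conn`: a connection from a vertex not connected to `d` is a connection of
  `G − d` (closure argument: the `G − d`-cluster of the vertex is closed under open adjacency of
  `G`, because an open edge into `d` would connect the vertex to `d`).
* `not_conn_d_of_not_mem_K2`: `p ∉ K₂`, `d ∈ K₂` ⟹ `p ≁ d`.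
* `conn_endsD_iff_of_mem_K2`, `conn_compl_endsD_iff_of_mem_M2`: the two one-colour identities.
* `sigma_endsD_of_mem_K2_M2`: `σ_pq` agrees with its `G − d` version when `d ∈ K₂ ∩ M₂` and
  `p, q` are separated (`sep2`).
Own work, one seat.
-/

namespace Summit.Ventures.PercRepro2

namespace NoPocket

open Finset Classical RegionHub OneColourSwitch SideSwitch

variable {V : Type*} {E : Type*}
variable {ends : E → Sym2 V} {d : V}

/-- A connection of `ω` starting at a vertex `a` that is not connected to `d` is a connection
of `G − d` (`endsD`): the path never meets `d`. -/
lemma conn_endsD_of_not_conn {ω : Config E} {a b : V} (hc : Conn ends ω a b)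
    (hd : ¬ Conn ends ω a d) : Conn (endsD ends d) ω a b := by
  have key : b ∈ {x | Conn (endsD ends d) ω a x} := by
    refine mem_of_conn_of_closed (ends := ends) (ω := ω) ?_ (conn_refl _ _ _) hc
    intro x hx y hxy
    obtain ⟨_, e, he, hends⟩ := openGraph_adj.1 hxy
    have hxa : Conn ends ω a x := conn_of_conn_endsD hx
    have hay : Conn ends ω a y := conn_trans hxa (conn_of_openAdj ⟨e, he, hends⟩)
    have hxd : x ≠ d := fun h => hd (h ▸ hxa)
    have hyd : y ≠ d := fun h => hd (h ▸ hay)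
    have hnd : d ∉ ends e := notMem_of_ends_ne hends hxd hyd
    have hends' : endsD ends d e = s(x, y) := by rw [endsD_of_notMem hnd, hends]
    exact conn_trans hx (conn_of_openAdj ⟨e, he, hends'⟩)
  exact key

/-- A vertex outside the `Y`-world of `{r, s}` is not connected to a vertex inside it. -/
lemma not_conn_d_of_not_mem_K2 {r s : V} {ω : Config E} {p : V} (hp : p ∉ K2 ends r s ω)
    (hd : d ∈ K2 ends r s ω) : ¬ Conn ends ω p d := by
  intro hc
  apply hp
  rcases mem_K2_iff.1 hd with h | h
  · exact mem_K2_iff.2 (Or.inl (conn_trans h (conn_symm hc)))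
  · exact mem_K2_iff.2 (Or.inr (conn_trans h (conn_symm hc)))

/-- **The `Y`-identity.** For `p ∉ K₂` and `d ∈ K₂`, the `Y`-connections of `p` in `G` and in
`G − d` coincide. -/
lemma conn_endsD_iff_of_mem_K2 {r s : V} {ω : Config E} {p q : V} (hp : p ∉ K2 ends r s ω)
    (hd : d ∈ K2 ends r s ω) : Conn ends ω p q ↔ Conn (endsD ends d) ω p q :=
  ⟨fun hc => conn_endsD_of_not_conn hc (not_conn_d_of_not_mem_K2 hp hd),
    fun hc => conn_of_conn_endsD hc⟩

/-- **The `W`-identity.** For `p ∉ M₂` and `d ∈ M₂`, the `W`-connections of `p` in `G` and in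
`G − d` coincide. -/
lemma conn_compl_endsD_iff_of_mem_M2 {r s : V} {ω : Config E} {p q : V}
    (hp : p ∉ M2 ends r s ω) (hd : d ∈ M2 ends r s ω) :
    Conn ends (OneColourSwitch.compl ω) p q ↔
      Conn (endsD ends d) (OneColourSwitch.compl ω) p q :=
  conn_endsD_iff_of_mem_K2 (r := r) (s := s) (ω := OneColourSwitch.compl ω) hp hd

/-- **The A-point identity.** Under `sep2`, when `d ∈ K₂`, the `Y`-indicator of `p ~ q` is the
one of `G − d`. -/
lemma conn_pq_endsD_of_mem_K2 {p q r s : V} {ω : Config E} (hsep : sep2 ends p q r s ω)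
    (hK : d ∈ K2 ends r s ω) : Conn ends ω p q ↔ Conn (endsD ends d) ω p q :=
  conn_endsD_iff_of_mem_K2 (not_mem_K2_of_sep2 hsep).1 hK

/-- **The D-point identity.** Under `sep2`, when `d` lies in both worlds of `{r, s}`, the colour
preference `σ_pq` is the one of `G − d`. -/
lemma sigma_endsD_of_mem_K2_M2 {p q r s : V} {ω : Config E} (hsep : sep2 ends p q r s ω)
    (hK : d ∈ K2 ends r s ω) (hM : d ∈ M2 ends r s ω) :
    sigma ends ω p q = sigma (endsD ends d) ω p q := by
  obtain ⟨hpK, _⟩ := not_mem_K2_of_sep2 hsep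
  obtain ⟨hpM, _⟩ := not_mem_M2_of_sep2 hsep
  simp only [sigma, conn_endsD_iff_of_mem_K2 hpK hK, conn_compl_endsD_iff_of_mem_M2 hpM hM]

end NoPocket

end Summit.Ventures.PercRepro2
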